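import Mathlib
import HarnessLib
import Summits.NavierStokesRegularity.NavierStokesRegularity.Theorems.TrappingWindowRungThreeShadowingTransferFlow

/-!
# Shadowing in a certified flow tube with REACH-LIMITED restarts (abstract layer for
`ExactWindowRungThree.TransferBootstrapR`, item stmt-NavierStokesRegularity-23759)

Reach-limited variant of `…Theorems.TrappingWindowRungThreeShadowingTransferCore` (item stmt-22924):
there the two-point flow clause TUBE delivered restarted exact orbits on the full section horizon
`[0, τs]`; the repaired certificate `ExactFlowCertificateR` (item stmt-23758) only delivers them up
to the base orbit's own crossing time (`0 < u`, `t + u ≤ τq`, orbits on `[0, u]`).  The Lady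
Windermere fan never used more: the fan function `t ↦ Φ_{T-t}(S t)` follows the orbit issued at
time `t` only until the final time `T`.  `fan_step_var` = one fan step with an individual horizon
per orbit; `shadow_core_reach` = the core estimate `‖S T - x T‖ ≤ Λ δ T` from orbits on `[0, T - t]`
(Dini-derivative fan + Mathlib's fencing lemma `image_le_of_liminf_slope_right_le_deriv_boundary`);
`shadow_bootstrap_reach` = the first-exit upgrade on `[0, Tm]` from orbits on `[0, u]`, `t + u ≤ Tm`
(the core estimate is only invoked at end times `T < Tm`).

HONEST FRAMING: pure finite-dimensional ODE bookkeeping used by the MODEL-lattice route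
`ExactWindowRungThree` (rung TL-M3); nothing here is a statement about the Navier–Stokes
equations and NS regularity is NOT proved by anything in this file.
-/

noncomputable section

-- the sub-problem namespace repeats the summit name by design (D-0017)
set_option linter.dupNamespace false

namespace Summit.NavierStokesRegularity.NavierStokesRegularity.Theorems

namespace ShadowingTransfer

open Set Filter Topology NNReal

variable {E : Type*} [NormedAddCommGroup E] [NormedSpace ℝ E]

/-- One step of the Lady Windermere fan with individual horizons.  `y₀` is an exact orbit on
`[0, u₀]` (`b ≤ u₀`), `y₁` one on `[0, u₁]` (`b - a ≤ u₁`); `w`, `w'` are the exact orbits from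
`y₁ 0` and `y₀ a` delivered by the two-point flow clause, on horizons `≥ b - a`; by uniqueness
`w (b - a) = y₁ (b - a)` and `w' (b - a) = y₀ b`, so a bound on `‖w (b-a) - w' (b-a)‖` is a bound on
`‖y₁ (b - a) - y₀ b‖`. [folklore] -/
theorem fan_step_var {v : E → E} {A : Set E} {K : ℝ≥0} (hv : LipschitzOnWith K v A)
    {u₀ u₁ uw uw' a b C : ℝ} (ha : 0 ≤ a) (hab : a ≤ b) (hb : b ≤ u₀) (hb₁ : b - a ≤ u₁)
    (hbw : b - a ≤ uw) (hbw' : b - a ≤ uw')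
    {y₀ y₁ w w' : ℝ → E}
    (hy₀ : ∀ r ∈ Icc (0 : ℝ) u₀, HasDerivWithinAt y₀ (v (y₀ r)) (Icc 0 u₀) r ∧ y₀ r ∈ A)
    (hy₁ : ∀ r ∈ Icc (0 : ℝ) u₁, HasDerivWithinAt y₁ (v (y₁ r)) (Icc 0 u₁) r ∧ y₁ r ∈ A)
    (hw : ∀ r ∈ Icc (0 : ℝ) uw, HasDerivWithinAt w (v (w r)) (Icc 0 uw) r ∧ w r ∈ A)
    (hw' : ∀ r ∈ Icc (0 : ℝ) uw', HasDerivWithinAt w' (v (w' r)) (Icc 0 uw') r ∧ w' r ∈ A)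
    (hw0 : w 0 = y₁ 0) (hw'0 : w' 0 = y₀ a)
    (hww' : ‖w (b - a) - w' (b - a)‖ ≤ C) :
    ‖y₁ (b - a) - y₀ b‖ ≤ C := by
  have e1 : w (b - a) = y₁ (b - a) :=
    flow_unique hv hw hy₁ hw0 (b - a) ⟨by linarith, le_min hbw hb₁⟩
  have hsh := flow_shift (v := v) (A := A) ha hy₀
  have hw'0' : w' 0 = (fun r' => y₀ (r' + a)) 0 := by simpa using hw'0
  have e2 : w' (b - a) = y₀ (b - a + a) :=
    flow_unique hv hw' (y₂ := fun r' => y₀ (r' + a)) hsh hw'0' (b - a)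
      ⟨by linarith, le_min hbw' (by linarith)⟩
  rw [sub_add_cancel] at e2
  rwa [← e1, ← e2]

/-- **Shadowing in a certified flow tube, reach-limited core estimate.**  `S` is a `C¹`
pseudo-orbit of `v` on `[0, T]` with defect `≤ δ`, starting on the exact orbit `x` and staying
`ρ`-close to it with `ρ < κ`; from every two points of the closed `κ`-tube around `x` at time `t`
exact orbits exist UP TO THE FINAL TIME (on `[0, T - t]`), stay in `A` (where `v` is Lipschitz with
speed `≤ Vmax`) and separate at most by the factor `Λ`.  Then `‖S T - x T‖ ≤ Λ δ T`.
(Dini-derivative form of the Lady Windermere fan; see the module docstring.) [folklore] -/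
theorem shadow_core_reach {v : E → E} {A : Set E} {K : ℝ≥0} (hv : LipschitzOnWith K v A)
    {Vmax : ℝ} (hVmax : ∀ e ∈ A, ‖v e‖ ≤ Vmax)
    {T κ ρ Λ δ : ℝ} (hT : 0 < T) (hρκ : ρ < κ) (hΛ : 0 ≤ Λ)
    {x S S' : ℝ → E}
    (hx : ∀ t ∈ Icc (0 : ℝ) T, HasDerivWithinAt x (v (x t)) (Icc 0 T) t ∧ x t ∈ A)
    (hS : ∀ t ∈ Icc (0 : ℝ) T, HasDerivWithinAt S (S' t) (Icc 0 T) t)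
    (hdef : ∀ t ∈ Ico (0 : ℝ) T, ‖S' t - v (S t)‖ ≤ δ)
    (h0 : S 0 = x 0)
    (hρ : ∀ t ∈ Icc (0 : ℝ) T, ‖S t - x t‖ ≤ ρ)
    (htube : ∀ t ∈ Icc (0 : ℝ) T, ∀ z z' : E, ‖z - x t‖ ≤ κ → ‖z' - x t‖ ≤ κ →
      ∃ y y' : ℝ → E, y 0 = z ∧ y' 0 = z' ∧ ∀ r ∈ Icc (0 : ℝ) (T - t),
        (HasDerivWithinAt y (v (y r)) (Icc 0 (T - t)) r ∧ y r ∈ A) ∧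
        (HasDerivWithinAt y' (v (y' r)) (Icc 0 (T - t)) r ∧ y' r ∈ A) ∧
        ‖y r - y' r‖ ≤ Λ * ‖z - z'‖) :
    ‖S T - x T‖ ≤ Λ * δ * T := by
  have hρκ' : ρ ≤ κ := hρκ.le
  -- exact orbits issued from the pseudo-orbit points, followed up to the final time `T`
  have hex : ∀ t : ℝ, ∃ y : ℝ → E, t ∈ Icc (0 : ℝ) T → (y 0 = S t ∧
      ∀ r ∈ Icc (0 : ℝ) (T - t), HasDerivWithinAt y (v (y r)) (Icc 0 (T - t)) r ∧ y r ∈ A) := by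
    intro t
    by_cases ht : t ∈ Icc (0 : ℝ) T
    · obtain ⟨y, y', hy0, -, hy⟩ := htube t ht (S t) (S t) ((hρ t ht).trans hρκ')
        ((hρ t ht).trans hρκ')
      exact ⟨y, fun _ => ⟨hy0, fun r hr => (hy r hr).1⟩⟩
    · exact ⟨fun _ => 0, fun h => absurd h ht⟩
  choose Y hY using hex
  -- the fan function `g t = Φ_{T-t} (S t)`
  set g : ℝ → E := fun t => Y t (T - t) with hg_def
  have hT0 : (0 : ℝ) ∈ Icc (0 : ℝ) T := ⟨le_rfl, hT.le⟩
  have hTT : T ∈ Icc (0 : ℝ) T := ⟨hT.le, le_rfl⟩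
  have hg0 : g 0 = x T := by
    have h := flow_unique hv (hY 0 hT0).2 hx ((hY 0 hT0).1.trans h0) T
      ⟨hT.le, le_min (by linarith) le_rfl⟩
    simpa [hg_def] using h
  have hgT : g T = S T := by simp [hg_def, (hY T hTT).1]
  -- KEY fan estimate
  have key : ∀ t₀ ∈ Icc (0 : ℝ) T, ∀ t ∈ Icc t₀ T, ‖Y t₀ (t - t₀) - x t‖ ≤ κ →
      ‖g t - g t₀‖ ≤ Λ * ‖S t - Y t₀ (t - t₀)‖ := by
    intro t₀ ht₀ t ht htb
    have htT : t ∈ Icc (0 : ℝ) T := ⟨ht₀.1.trans ht.1, ht.2⟩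
    obtain ⟨w, w', hw0, hw'0, hww'⟩ :=
      htube t htT (S t) (Y t₀ (t - t₀)) ((hρ t htT).trans hρκ') htb
    have hmem : T - t₀ - (t - t₀) ∈ Icc (0 : ℝ) (T - t) :=
      ⟨by linarith [ht.2], by linarith⟩
    have h := fan_step_var hv (a := t - t₀) (b := T - t₀) (C := Λ * ‖S t - Y t₀ (t - t₀)‖)
      (u₀ := T - t₀) (u₁ := T - t) (uw := T - t) (uw' := T - t)
      (by linarith [ht.1]) (by linarith [ht.2]) le_rfl (by linarith) (by linarith) (by linarith)
      (hY t₀ ht₀).2 (hY t htT).2 (fun r hr => (hww' r hr).1) (fun r hr => (hww' r hr).2.1)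
      (hw0.trans (hY t htT).1.symm) hw'0 ((hww' _ hmem).2.2)
    rw [show T - t₀ - (t - t₀) = T - t by ring] at h
    simpa [hg_def] using h
  -- continuity data
  have hSc : ContinuousOn S (Icc 0 T) := fun t ht => (hS t ht).continuousWithinAt
  have hxc : ContinuousOn x (Icc 0 T) := fun t ht => (hx t ht).1.continuousWithinAt
  have hYc : ∀ t ∈ Icc (0 : ℝ) T, ContinuousOn (Y t) (Icc 0 (T - t)) :=
    fun t ht => flow_continuousOn (hY t ht).2
  -- right-sided limits at `t₀ ∈ [0, T)`
  have hright : ∀ t₀ ∈ Ico (0 : ℝ) T,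
      (∀ᶠ t in 𝓝[>] t₀, t ∈ Ioc t₀ T ∧ ‖Y t₀ (t - t₀) - x t‖ ≤ κ) ∧
      Tendsto (fun t => ‖S t - Y t₀ (t - t₀)‖) (𝓝[>] t₀) (𝓝 0) ∧
      Tendsto (fun t => (t - t₀)⁻¹ * ‖S t - Y t₀ (t - t₀)‖) (𝓝[>] t₀)
        (𝓝 ‖S' t₀ - v (S t₀)‖) := by
    intro t₀ ht₀
    have ht₀' : t₀ ∈ Icc (0 : ℝ) T := Ico_subset_Icc_self ht₀
    have hpos₀ : 0 < T - t₀ := sub_pos.mpr ht₀.2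
    have hle : 𝓝[>] t₀ ≤ 𝓝[Icc 0 T] t₀ := by
      rw [← nhdsWithin_Ioo_eq_nhdsGT ht₀.2]
      exact nhdsWithin_mono _ fun t ht => ⟨ht₀.1.trans ht.1.le, ht.2.le⟩
    have hIoo : Ioo t₀ T ∈ 𝓝[>] t₀ := Ioo_mem_nhdsGT ht₀.2
    have hsub0 : Tendsto (fun t : ℝ => t - t₀) (𝓝 t₀) (𝓝 0) :=
      tendsto_sub_nhds_zero_iff.mpr tendsto_id
    have hshift : Tendsto (fun t : ℝ => t - t₀) (𝓝[>] t₀) (𝓝[>] 0) := by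
      refine tendsto_nhdsWithin_of_tendsto_nhds_of_eventually_within _
        (hsub0.mono_left nhdsWithin_le_nhds) ?_
      filter_upwards [self_mem_nhdsWithin] with t ht
      simpa using ht
    have hshift' : Tendsto (fun t : ℝ => t - t₀) (𝓝[>] t₀) (𝓝[Icc 0 (T - t₀)] 0) := by
      refine tendsto_nhdsWithin_of_tendsto_nhds_of_eventually_within _
        (hsub0.mono_left nhdsWithin_le_nhds) ?_
      filter_upwards [hIoo] with t ht
      exact ⟨by linarith [ht.1], by linarith [ht.2]⟩
    have hYt : Tendsto (fun t => Y t₀ (t - t₀)) (𝓝[>] t₀) (𝓝 (S t₀)) := by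
      have h := ((hYc t₀ ht₀') 0 ⟨le_rfl, hpos₀.le⟩).tendsto.comp hshift'
      rw [(hY t₀ ht₀').1] at h
      exact h
    have hSt : Tendsto S (𝓝[>] t₀) (𝓝 (S t₀)) := ((hSc t₀ ht₀').tendsto).mono_left hle
    have hxt : Tendsto x (𝓝[>] t₀) (𝓝 (x t₀)) := ((hxc t₀ ht₀').tendsto).mono_left hle
    refine ⟨?_, ?_, ?_⟩
    · have h1 : Tendsto (fun t => ‖Y t₀ (t - t₀) - x t‖) (𝓝[>] t₀) (𝓝 ‖S t₀ - x t₀‖) :=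
        (hYt.sub hxt).norm
      have h2 : ‖S t₀ - x t₀‖ < κ := (hρ t₀ ht₀').trans_lt hρκ
      filter_upwards [Filter.Tendsto.eventually_lt_const h2 h1, Ioc_mem_nhdsGT ht₀.2]
        with t ht ht'
      exact ⟨ht', ht.le⟩
    · have h := (hSt.sub hYt).norm
      simpa using h
    · have hS' : HasDerivWithinAt S (S' t₀) (Ioi t₀) t₀ :=
        (hS t₀ ht₀').mono_of_mem_nhdsWithin
          (mem_of_superset hIoo fun t ht => ⟨ht₀.1.trans ht.1.le, ht.2.le⟩)
      have hslS : Tendsto (slope S t₀) (𝓝[>] t₀) (𝓝 (S' t₀)) :=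
        (hasDerivWithinAt_iff_tendsto_slope' (show t₀ ∉ Ioi t₀ from lt_irrefl t₀)).1 hS'
      have hY' : HasDerivWithinAt (Y t₀) (v (S t₀)) (Ioi 0) 0 := by
        have h := ((hY t₀ ht₀').2 0 ⟨le_rfl, hpos₀.le⟩).1
        rw [(hY t₀ ht₀').1] at h
        exact h.mono_of_mem_nhdsWithin
          (mem_of_superset (Ioo_mem_nhdsGT hpos₀) Ioo_subset_Icc_self)
      have hslY : Tendsto (fun t => slope (Y t₀) 0 (t - t₀)) (𝓝[>] t₀) (𝓝 (v (S t₀))) :=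
        ((hasDerivWithinAt_iff_tendsto_slope' (show (0 : ℝ) ∉ Ioi 0 by simp)).1
          hY').comp hshift
      have hdiff := (hslS.sub hslY).norm
      refine hdiff.congr' ?_
      filter_upwards [self_mem_nhdsWithin] with t ht
      have hpos : 0 < t - t₀ := sub_pos.mpr ht
      rw [slope_def_module, slope_def_module, sub_zero, (hY t₀ ht₀').1, ← smul_sub,
        norm_smul, Real.norm_eq_abs, abs_of_pos (inv_pos.mpr hpos)]
      congr 1
      abel
  -- continuity of `g` on `[0, T]`
  have hgc : ContinuousOn g (Icc 0 T) := by
    intro t₀ ht₀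
    have hR : ContinuousWithinAt g (Icc t₀ T) t₀ := by
      rcases eq_or_lt_of_le ht₀.2 with h | h
      · rw [h, Icc_self]
        exact continuousWithinAt_singleton
      · obtain ⟨hev, hlim, -⟩ := hright t₀ ⟨ht₀.1, h⟩
        rw [continuousWithinAt_Icc_iff_Ici h, ← continuousWithinAt_Ioi_iff_Ici,
          ContinuousWithinAt, ← tendsto_sub_nhds_zero_iff]
        refine squeeze_zero_norm' ?_ ?_ (a := fun t => Λ * ‖S t - Y t₀ (t - t₀)‖)
        · filter_upwards [hev] with t ht
          exact key t₀ ht₀ t ⟨ht.1.1.le, ht.1.2⟩ ht.2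
        · simpa using hlim.const_mul Λ
    have hL : ContinuousWithinAt g (Icc 0 t₀) t₀ := by
      rcases eq_or_lt_of_le ht₀.1 with h | h
      · rw [← h, Icc_self]
        exact continuousWithinAt_singleton
      · have hle : 𝓝[<] t₀ ≤ 𝓝[Icc 0 T] t₀ := by
          rw [← nhdsWithin_Ioo_eq_nhdsLT h]
          exact nhdsWithin_mono _ fun t ht => ⟨ht.1.le, ht.2.le.trans ht₀.2⟩
        have hSt : Tendsto S (𝓝[<] t₀) (𝓝 (S t₀)) := ((hSc t₀ ht₀).tendsto).mono_left hle
        have hxt : Tendsto x (𝓝[<] t₀) (𝓝 (x t₀)) := ((hxc t₀ ht₀).tendsto).mono_left hle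
        have hdrift : ∀ t ∈ Ico (0 : ℝ) t₀, ‖Y t (t₀ - t) - S t‖ ≤ Vmax * (t₀ - t) := by
          intro t ht
          have htI : t ∈ Icc (0 : ℝ) T := ⟨ht.1, ht.2.le.trans ht₀.2⟩
          have hd := flow_drift hVmax (hY t htI).2 (t₀ - t)
            ⟨by linarith [ht.2], by linarith [ht₀.2]⟩
          rwa [(hY t htI).1] at hd
        have hVt : Tendsto (fun t => Vmax * (t₀ - t)) (𝓝[<] t₀) (𝓝 0) := by
          have h' : Tendsto (fun t : ℝ => Vmax * (t₀ - t)) (𝓝 t₀) (𝓝 (Vmax * (t₀ - t₀))) :=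
            (continuous_const.mul (continuous_const.sub continuous_id)).tendsto t₀
          rw [sub_self, mul_zero] at h'
          exact h'.mono_left nhdsWithin_le_nhds
        have hev : ∀ᶠ t in 𝓝[<] t₀, t ∈ Ioo 0 t₀ ∧ ‖Y t (t₀ - t) - x t₀‖ ≤ κ := by
          have h1 : Tendsto (fun t => Vmax * (t₀ - t) + ρ + ‖x t - x t₀‖) (𝓝[<] t₀)
              (𝓝 (0 + ρ + 0)) := by
            refine (hVt.add tendsto_const_nhds).add ?_
            have h' := (hxt.sub_const (x t₀)).norm
            simpa using h'
          have h2 : (0 : ℝ) + ρ + 0 < κ := by simpa using hρκ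
          filter_upwards [Filter.Tendsto.eventually_lt_const h2 h1, Ioo_mem_nhdsLT h]
            with t ht ht'
          refine ⟨ht', ?_⟩
          have htI : t ∈ Icc (0 : ℝ) T := ⟨ht'.1.le, ht'.2.le.trans ht₀.2⟩
          calc ‖Y t (t₀ - t) - x t₀‖
              ≤ ‖Y t (t₀ - t) - S t‖ + ‖S t - x t‖ + ‖x t - x t₀‖ := by
                calc ‖Y t (t₀ - t) - x t₀‖
                    ≤ ‖Y t (t₀ - t) - x t‖ + ‖x t - x t₀‖ := norm_sub_le_norm_sub_add_norm_sub _ _ _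
                  _ ≤ ‖Y t (t₀ - t) - S t‖ + ‖S t - x t‖ + ‖x t - x t₀‖ := by
                    gcongr
                    exact norm_sub_le_norm_sub_add_norm_sub _ _ _
            _ ≤ Vmax * (t₀ - t) + ρ + ‖x t - x t₀‖ := by
                gcongr
                · exact hdrift t ⟨ht'.1.le, ht'.2⟩
                · exact hρ t htI
            _ ≤ κ := ht.le
        rw [continuousWithinAt_Icc_iff_Iic h, ← continuousWithinAt_Iio_iff_Iic,
          ContinuousWithinAt, ← tendsto_sub_nhds_zero_iff]
        refine squeeze_zero_norm' ?_ ?_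
          (a := fun t => Λ * (‖S t₀ - S t‖ + Vmax * (t₀ - t)))
        · filter_upwards [hev] with t ht
          have htI : t ∈ Icc (0 : ℝ) T := ⟨ht.1.1.le, ht.1.2.le.trans ht₀.2⟩
          have hk := key t htI t₀ ⟨ht.1.2.le, ht₀.2⟩ ht.2
          rw [norm_sub_rev]
          refine hk.trans (mul_le_mul_of_nonneg_left ?_ hΛ)
          calc ‖S t₀ - Y t (t₀ - t)‖ ≤ ‖S t₀ - S t‖ + ‖S t - Y t (t₀ - t)‖ :=
                norm_sub_le_norm_sub_add_norm_sub _ _ _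
            _ ≤ ‖S t₀ - S t‖ + Vmax * (t₀ - t) := by
                rw [norm_sub_rev (S t)]
                gcongr
                exact hdrift t ⟨ht.1.1.le, ht.1.2⟩
        · have h' : Tendsto (fun t => Λ * (‖S t₀ - S t‖ + Vmax * (t₀ - t))) (𝓝[<] t₀)
              (𝓝 (Λ * (0 + 0))) := by
            refine (Tendsto.add ?_ hVt).const_mul Λ
            have h'' := (hSt.const_sub (S t₀)).norm
            simpa using h''
          simpa using h'
    have h := hL.union hR
    rwa [Icc_union_Icc_eq_Icc ht₀.1 ht₀.2] at h
  -- the fencing argument on `f t = ‖g t - x T‖`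
  set f : ℝ → ℝ := fun t => ‖g t - x T‖ with hf_def
  have hfc : ContinuousOn f (Icc 0 T) := (hgc.sub continuousOn_const).norm
  have hfa : f 0 ≤ Λ * δ * 0 := by simp [hf_def, hg0]
  have hB : ContinuousOn (fun t => Λ * δ * t) (Icc 0 T) :=
    (continuous_const.mul continuous_id).continuousOn
  have hB' : ∀ t ∈ Ico (0 : ℝ) T, HasDerivWithinAt (fun t => Λ * δ * t) (Λ * δ) (Ici t) t := by
    intro t _
    simpa using ((hasDerivWithinAt_id t (Ici t)).const_mul (Λ * δ))
  have bound : ∀ t ∈ Ico (0 : ℝ) T, ∀ r, Λ * δ < r → ∃ᶠ z in 𝓝[>] t, slope f t z < r := by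
    intro t₀ ht₀ r hr
    obtain ⟨hev, -, hsl⟩ := hright t₀ ht₀
    have hL : ‖S' t₀ - v (S t₀)‖ ≤ δ := hdef t₀ ht₀
    have hlt : Λ * ‖S' t₀ - v (S t₀)‖ < r := (mul_le_mul_of_nonneg_left hL hΛ).trans_lt hr
    have hev2 := Filter.Tendsto.eventually_lt_const hlt (hsl.const_mul Λ)
    refine ((hev.and hev2).mono fun t ht => ?_).frequently
    obtain ⟨⟨ht1, ht2⟩, ht3⟩ := ht
    have hpos : 0 < t - t₀ := sub_pos.mpr ht1.1
    have hgg : f t - f t₀ ≤ ‖g t - g t₀‖ := by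
      have h := norm_sub_norm_le (g t - x T) (g t₀ - x T)
      rwa [sub_sub_sub_cancel_right] at h
    calc slope f t₀ t = (t - t₀)⁻¹ * (f t - f t₀) := by
          rw [slope_def_field, div_eq_inv_mul]
      _ ≤ (t - t₀)⁻¹ * ‖g t - g t₀‖ :=
          mul_le_mul_of_nonneg_left hgg (inv_nonneg.mpr hpos.le)
      _ ≤ (t - t₀)⁻¹ * (Λ * ‖S t - Y t₀ (t - t₀)‖) :=
          mul_le_mul_of_nonneg_left (key t₀ (Ico_subset_Icc_self ht₀) t ⟨ht1.1.le, ht1.2⟩ ht2)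
            (inv_nonneg.mpr hpos.le)
      _ = Λ * ((t - t₀)⁻¹ * ‖S t - Y t₀ (t - t₀)‖) := by ring
      _ < r := ht3
  have h := image_le_of_liminf_slope_right_le_deriv_boundary hfc hfa hB hB' bound hTT
  simpa [hf_def, hgT] using h

/-- **First-exit bootstrap for the reach-limited tube shadowing estimate.**  If `Λ δ τs < κ`, the
exact orbit `x` keeps the closed `(Λ δ τs)`-ball (with a margin `m`) inside the region `A` where the
defect bound of the pseudo-orbit `S` is available, and the two-point flow clause at time
`t ∈ [0, Tm]` delivers exact orbits on `[0, u]` for every `0 < u` with `t + u ≤ Tm` (restarts never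
reach past the base orbit's end time), then `‖S t - x t‖ ≤ Λ δ t` on `[0, Tm]` (`Tm ≤ τs`);
continuous induction, invoking `shadow_core_reach` only at end times `T < Tm`. [folklore] -/
theorem shadow_bootstrap_reach {v : E → E} {A : Set E} {K : ℝ≥0} (hv : LipschitzOnWith K v A)
    {Vmax : ℝ} (hVmax : ∀ e ∈ A, ‖v e‖ ≤ Vmax)
    {τs Tm κ Λ δ m : ℝ} (hTmτ : Tm ≤ τs) (hΛ : 0 ≤ Λ) (hδ : 0 ≤ δ) (hm : 0 < m)
    (hgap : Λ * δ * τs < κ)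
    {x S S' : ℝ → E}
    (hx : ∀ t ∈ Icc (0 : ℝ) Tm, HasDerivWithinAt x (v (x t)) (Icc 0 Tm) t ∧ x t ∈ A)
    (hS : ∀ t ∈ Icc (0 : ℝ) Tm, HasDerivWithinAt S (S' t) (Icc 0 Tm) t)
    (hdef : ∀ t ∈ Ico (0 : ℝ) Tm, S t ∈ A → ‖S' t - v (S t)‖ ≤ δ)
    (hinner : ∀ t ∈ Icc (0 : ℝ) Tm, ∀ z : E, ‖z - x t‖ < Λ * δ * τs + m → z ∈ A)
    (h0 : S 0 = x 0)
    (htube : ∀ t ∈ Icc (0 : ℝ) Tm, ∀ z z' : E, ‖z - x t‖ ≤ κ → ‖z' - x t‖ ≤ κ →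
      ∀ u : ℝ, 0 < u → t + u ≤ Tm →
      ∃ y y' : ℝ → E, y 0 = z ∧ y' 0 = z' ∧ ∀ r ∈ Icc (0 : ℝ) u,
        (HasDerivWithinAt y (v (y r)) (Icc 0 u) r ∧ y r ∈ A) ∧
        (HasDerivWithinAt y' (v (y' r)) (Icc 0 u) r ∧ y' r ∈ A) ∧
        ‖y r - y' r‖ ≤ Λ * ‖z - z'‖) :
    ∀ t ∈ Icc (0 : ℝ) Tm, ‖S t - x t‖ ≤ Λ * δ * t := by
  set s : Set ℝ := {t | ‖S t - x t‖ ≤ Λ * δ * t} with hs_def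
  have hSc : ContinuousOn S (Icc 0 Tm) := fun t ht => (hS t ht).continuousWithinAt
  have hxc : ContinuousOn x (Icc 0 Tm) := fun t ht => (hx t ht).1.continuousWithinAt
  have hclosed : IsClosed (s ∩ Icc 0 Tm) := by
    have e : s ∩ Icc 0 Tm = {t ∈ Icc (0 : ℝ) Tm | ‖S t - x t‖ ≤ Λ * δ * t} := by
      ext t
      simp only [hs_def, mem_inter_iff, mem_setOf_eq]
      tauto
    rw [e]
    exact isClosed_Icc.isClosed_le ((hSc.sub hxc).norm) (continuousOn_const.mul continuousOn_id)
  have h0s : (0 : ℝ) ∈ s := by simp [hs_def, h0]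
  have hΛδ : 0 ≤ Λ * δ := mul_nonneg hΛ hδ
  refine fun t ht => hclosed.Icc_subset_of_forall_mem_nhdsGT_of_Icc_subset h0s ?_ ht
  intro t ht hst
  have htI : t ∈ Icc (0 : ℝ) Tm := Ico_subset_Icc_self ht
  -- an intermediate closeness radius `Λ δ τs < ρ < min κ (Λ δ τs + m)`
  set ρ : ℝ := Λ * δ * τs + min (κ - Λ * δ * τs) m / 2 with hρ_def
  have hmin : 0 < min (κ - Λ * δ * τs) m := lt_min (by linarith) hm
  have hρ1 : Λ * δ * τs < ρ := by rw [hρ_def]; linarith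
  have hρκ : ρ < κ := by have := min_le_left (κ - Λ * δ * τs) m; rw [hρ_def]; linarith
  have hρm : ρ < Λ * δ * τs + m := by have := min_le_right (κ - Λ * δ * τs) m; rw [hρ_def]; linarith
  -- the past: `‖S - x‖ ≤ Λ δ τs` on `[0, t]`
  have hpast : ∀ t' ∈ Icc (0 : ℝ) t, ‖S t' - x t'‖ ≤ Λ * δ * τs := by
    intro t' ht'
    exact (hst ht').trans (mul_le_mul_of_nonneg_left (by linarith [ht'.2, ht.2, hTmτ]) hΛδ)
  -- continuity: strictly `ρ`-close on a right neighbourhood of `t`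
  have hle : 𝓝[>] t ≤ 𝓝[Icc 0 Tm] t := by
    rw [← nhdsWithin_Ioo_eq_nhdsGT ht.2]
    exact nhdsWithin_mono _ fun t' ht' => ⟨ht.1.trans ht'.1.le, ht'.2.le⟩
  have hev : ∀ᶠ t' in 𝓝[>] t, ‖S t' - x t'‖ < ρ ∧ t' ∈ Ioo t Tm := by
    have h1 : Tendsto (fun t' => ‖S t' - x t'‖) (𝓝[>] t) (𝓝 ‖S t - x t‖) :=
      (((hSc t htI).sub (hxc t htI)).norm.tendsto).mono_left hle
    exact (Filter.Tendsto.eventually_lt_const ((hpast t ⟨ht.1, le_rfl⟩).trans_lt hρ1) h1).and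
      (Ioo_mem_nhdsGT ht.2)
  obtain ⟨u, hu, hsub⟩ := mem_nhdsGT_iff_exists_Ioo_subset.mp hev
  refine mem_of_superset (Ioo_mem_nhdsGT hu) fun T hT => ?_
  obtain ⟨hTρ, hTt, hTTm'⟩ := hsub hT
  have hT0 : 0 < T := ht.1.trans_lt hT.1
  have hTTm : T ≤ Tm := hTTm'.le
  have hρall : ∀ t' ∈ Icc (0 : ℝ) T, ‖S t' - x t'‖ ≤ ρ := by
    intro t' ht'
    rcases le_or_gt t' t with h | h
    · exact (hpast t' ⟨ht'.1, h⟩).trans hρ1.le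
    · rcases eq_or_lt_of_le ht'.2 with h' | h'
      · rw [h']
        exact hTρ.le
      · exact (hsub ⟨h, h'.trans hT.2⟩).1.le
  have hA : ∀ t' ∈ Icc (0 : ℝ) T, S t' ∈ A := fun t' ht' =>
    hinner t' ⟨ht'.1, ht'.2.trans hTTm⟩ (S t') ((hρall t' ht').trans_lt hρm)
  -- restarted orbits from time `t' ≤ T` reach `Tm > T`, hence cover `[0, T - t']`
  have htubeT : ∀ t' ∈ Icc (0 : ℝ) T, ∀ z z' : E, ‖z - x t'‖ ≤ κ → ‖z' - x t'‖ ≤ κ →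
      ∃ y y' : ℝ → E, y 0 = z ∧ y' 0 = z' ∧ ∀ r ∈ Icc (0 : ℝ) (T - t'),
        (HasDerivWithinAt y (v (y r)) (Icc 0 (T - t')) r ∧ y r ∈ A) ∧
        (HasDerivWithinAt y' (v (y' r)) (Icc 0 (T - t')) r ∧ y' r ∈ A) ∧
        ‖y r - y' r‖ ≤ Λ * ‖z - z'‖ := by
    intro t' ht' z z' hz hz'
    have hu' : 0 < Tm - t' := by linarith [ht'.2]
    obtain ⟨y, y', hy0, hy'0, hyy'⟩ :=
      htube t' ⟨ht'.1, ht'.2.trans hTTm⟩ z z' hz hz' (Tm - t') hu' (by linarith)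
    have hsub' : Icc (0 : ℝ) (T - t') ⊆ Icc 0 (Tm - t') := Icc_subset_Icc_right (by linarith)
    exact ⟨y, y', hy0, hy'0, fun r hr => ⟨⟨(hyy' r (hsub' hr)).1.1.mono hsub',
      (hyy' r (hsub' hr)).1.2⟩, ⟨(hyy' r (hsub' hr)).2.1.1.mono hsub', (hyy' r (hsub' hr)).2.1.2⟩,
      (hyy' r (hsub' hr)).2.2⟩⟩
  show ‖S T - x T‖ ≤ Λ * δ * T
  exact shadow_core_reach hv hVmax hT0 hρκ hΛ
    (fun t' ht' => ⟨(hx t' ⟨ht'.1, ht'.2.trans hTTm⟩).1.mono (Icc_subset_Icc_right hTTm),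
      (hx t' ⟨ht'.1, ht'.2.trans hTTm⟩).2⟩)
    (fun t' ht' => (hS t' ⟨ht'.1, ht'.2.trans hTTm⟩).mono (Icc_subset_Icc_right hTTm))
    (fun t' ht' => hdef t' ⟨ht'.1, ht'.2.trans_le hTTm⟩ (hA t' (Ico_subset_Icc_self ht')))
    h0 hρall htubeT

end ShadowingTransfer

end Summit.NavierStokesRegularity.NavierStokesRegularity.Theorems

end
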